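import Literature.NumberTheory.LFunctions.ExplicitDeuringHeilbronnDirichletFamily
import Literature.NumberTheory.LFunctions.ExplicitBurgessBoundDirichlet
import Literature.NumberTheory.LFunctions.DirichletLZeroCountExplicit
import Literature.NumberTheory.LFunctions.ConditionalLOneBoundsGRH
import HarnessLib

/-!
# Zhang (2022), rung F-S3, family B-dh: the EXPLICIT-CHAIN MENU over an abstract zero world and the (A)-world
# `W(D, χ)` — statement `Zhang2022.DH.MenuConsistent` (B-DH-W, dhE-24: the family's KILL-certificate target)

Y. Zhang, *Discrete mean estimates and the Landau–Siegel zero*, arXiv:2211.02515v1 [Zhang2022LandauSiegel] — an unrefereed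
manuscript under adjudication. **The programme SEARCHES and TYPES; no claim about Landau–Siegel zeros, Theorems 1–2 of
arXiv:2211.02515 or a repaired Margin232 until a kernel theorem says so.** Cell `landau-siegel`: B-dh/PLAN.md §5,
KILL-draft.md v1.2 (§2 menu M, §3 world W⁺, §5), EDLIST.md row dhE-24, REF.md (ls-B-ref-3) R1–R5 and A1–A9, ls-ref-1 (a)(b).
Nothing here is a theorem about a Dirichlet `L`-function; the one `Prop` of record, `MenuConsistent`, is a TARGET (§E).

## What is typed

A B-dh design is a chain `(A) ∧ E₁ ∧ … ∧ E_k ⟹ Φ_d ≥ 0` over menu rows `E_i` (explicit DH / zero-density / ZFR / zero-count /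
`L(1,χ)` statements, each TYPED in the tree about `DirichletCharacter.LFunction`). It can close only if the rows, read as
constraints on ZERO AND VALUE DATA, are jointly inconsistent with (A). Here:
* `ZeroWorld` — data per slot `(q, ψ)` (`ψ : DirichletCharacter ℂ q` as an INDEX only): `mult q ψ : ℂ → ℕ` (nontrivial-zero
  multiplicities), `LOne q ψ` ("`|L(1,ψ)|`"), `Lhalf q ψ t` ("`|L(½+it,ψ)|`"), `psi q a x` ("`ψ(x; q, a)`", carried for the
  prime-side rows P7 of KILL-draft §2, rendered in the companion file `DHChainBarrierPrimes`). The tree's counting objects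
  are rebuilt over a world VERBATIM: `stripCount` = `lfunctionZeroCount`, `zeroSetRe`/`charZeroCountRe` = `BondarenkoHeap2026.*`,
  `realZeroSet`/`betaOne`/`zeroCount`/`zeroCountExcl` = `ThornerZaman2024.*`, with `L(ρ,χ) = 0 ↦ 0 < w.mult q χ ρ`,
  `zeroOrder ↦ w.mult`. (A6: `betaOne Q = sSup ∅ = 0` when no slot `q ≤ Q` has a real zero, so the `N*` factor
  `min{1,(1−β₁(Q)) log Q}` is `1` for `3 ≤ Q < D`.)
* `ZeroWorld.Menu w D χ : Prop` — a STRUCTURE, ONE FIELD PER TYPED INPUT ROW (ls-ref-1 (a)), each the typed decl's statement with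
  its printed ranges on the world's data (R5): `assumptionA` ↔ `Zhang2022.Skeleton.AssumptionA`; `row01` ↔ `BGTZ2025.corollary11`
  (`Repulsion 10 1 107 (1/16)`, binder `1/2 < Re ρ` STRICT, R4c); `row02` ↔ `BGTZ2025.theorem13` (`hypothesisA` ↔
  `BGTZ2025.HypothesisA` on `Lhalf`); `row03` ↔ `BGTZ2025.proposition24_thornerZaman` ∧ `francis2022_theorem13` (half-line
  display; the σ-displays need off-line values the world does not carry); `row04` ↔ `thornerZaman2024_theorem12` ∧ `_corollary61`
  (all `σ ≥ 0`: the fence IS counted, R4b/A5 — fence total `≍ Q³ log Q` vs `10²⁹⁸ Q⁶³`); `row05` ↔ `thornerZaman2024_lemma24` ∧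
  `_corollary25` ∧ `_theorem26a` ∧ `_theorem26b`; `row06` ↔ `thornerZaman2024_theorem215`; `row08` ↔ `McCurley1984_theorem1`
  (`AtMostOneZeroInRegion 9.645908801 10`) ∧ `luZamanZhao2026_theorem11`; `row09` ↔ `BGTZ2025.lemma29` (on `LOne` = the real
  number `L(1,χ₁)` of a quadratic `χ₁`); `row10` ↔ `BGTZ2025.theorem28_bordignon` (`HypothesisB 100 (1/2)`) ∧
  `RealZeroRepulsion.one_sub_realZero_ge_explicit_of_eight_le`; `row11` ↔ `DirichletLOneLogBound.norm_LFunction_one_le_log`;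
  `row12` ↔ the conclusion of `Zhang2022.DH.exceptionalZero_of_assumptionA` (dhE-12, at the datum); `row13` ↔ `bmor2021_theorem11` (two-sided RvM band,
  CLOSED strip, R4a); `row15` ↔ `RealZeroRepulsion.norm_LFunction_one_ge`; `row19` ↔ `lamzouriLiSoundararajan2015_theorem15`
  with GRH read over the world (false in any world with `β₁` — inert, recorded on purpose); structural rows (A4) `rowS1`
  (conjugation `ψ ↦ ψ⁻¹, ρ ↦ ρ̄` and functional-equation `ρ ↦ 1 − ρ̄` symmetry of the zero data), `rowS2` (counts monotone),
  `rowS3` (`|L(1,ψ)| > 0` for `ψ ≠ χ₀`, `|L(1,ψ̄)| = |L(1,ψ)|`, `|L(½+it)| ≥ 0`), `rowS4` (an imprimitive character carries its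
  inducer's zeros, and no others off `Re s = 0`).
* OUTSIDE the rendered menu, BY ID (A7/R1 — **scope: menu = EDLIST rows as rendered here; any new input row, or one rendered
  more strongly, re-opens the certificate**): dhE-07 (`∃C` inexplicit), Kadiri `∃R₀`, BGTZ Cor 1.2 (`∃C(ε)`), dhE-14/16/18/20
  (untyped / locators pending: critical-line zeros, Oesterlé, GS values and `Ω`, Selberg CLT), dhE-17 (skeleton Part-1 rows:
  DROPPED, A2), the UniformABC row (`granville_stark_noSiegelZeros`: hypothesis is not zero data), the prime rows P7 and `rowS5`
  (companion file), dhE-23 (tail schema).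
* THE (A)-WORLD `world D χ` (KILL-draft §3, R3/R4/A4): `λ := 1/(2 (log D)^2022)` (`lam`), `β₁ := 1 − λ/0.75` (`betaExc`); slot
  `(q, ψ)` carries the symmetric RvM PICKET FENCE of the CONDUCTOR of `ψ`: `fence f = {½ ± iγ_n(f) : n ≥ 1}`,
  `γ_n(f) := inf{T ≥ 0 : 2n − 1 ≤ (T/π) log(fT/2πe)}` (so `N(T) = 2⌊(F(T)+1)/2⌋₊ ∈ (F−1, F+1]`, inside every BMOR band: error
  `≤ 1.25 < 1.7417` at the edge `ℓ → 1.567⁺`, and `N = 0` for `ℓ ≤ 1.567`, `f ≥ 3`); the slots INDUCED from `χ` (`D ∣ q`,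
  `ψ = changeLevel χ`) carry in addition the simple real zeros `β₁`, `1 − β₁` and `LOne = λ`; other `LOne = 1`; `Lhalf ≡ 1`;
  `psi q a x` = the Siegel main term `(x − χ(a) x^{β₁}/β₁)/φ(q)` on induced moduli, `x/φ(q)` otherwise (`(a,q) = 1`).
* **`MenuConsistent`**: for every `D` with `log D ≥ 43 250` and every primitive quadratic `χ ≠ χ₀` mod `D`, `Menu (world D χ) D χ`.
  Meta-reading (KILL-draft §1, not Lean): no chain over the rendered menu derives `¬(A)_D` for any `log D ≥ 43 250` (A9: for
  smaller `D` the menu IS inconsistent with (A) — dh-cnf-001/002 — immaterial by `Skeleton.theorem1_of_eventually_not_assumptionA`).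

Road map for §E (numbers at `𝓛 = log D ≥ 43 250`): P1 rows have empty range in `W`; row04 `≤ 1` vs `10⁸⁸` (`σ ≥ ½`) and
`Q³ log Q` vs `10²⁹⁸Q⁶³` (`σ < ½`; `N*` factor costs `𝓛^{2022}` against `Q^{96}`); row13 as above; row09 `0.96λ ≤ λ ≤ 0.24λ log²q`;
row10/row05-26b `𝓛/2 > log 150 + 2020 log 𝓛`; row15 `𝓛/2 ≥ log 1.38 + 2022 log 𝓛`; (A) `λ < 𝓛^{−2022}`; row12 `λ/0.75 < 1/(10𝓛)`, `0.96λ ≤ λ`, `λ/0.75 = (2/3)𝓛^{−2022} < (25/18)𝓛^{−2022}`.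
Certified numeric companion of these lines: ls-Bdh-num-1, B-dh/num-1/jobs/j258910/MENULINES-A.json (row13(a) tight at `q = 3`,
margin `0.118`; row04 log-margin `≤ −747` at `Q = 3`; rows 05/06/08 window gaps `≥ 0.4056`; row11 `log 3 − 1 = 0.0986`).
WHAT THIS IS NOT: a proof (→ §E), a statement about any actual `L`-function, a verdict. No instance, no notation.
-/

noncomputable section

open scoped Classical
open Complex

namespace Literature.NumberTheory.LFunctions.Zhang2022.DH

/-! ## 1. Abstract zero worlds and the tree's counting objects over them -/

/-- ABSTRACT ZERO / VALUE / PRIME-COUNT DATA indexed by Dirichlet-character slots `(q, ψ)` — the "one exceptional zero world"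
device of the Deuring–Heilbronn literature as a Lean object; no `L`-function occurs. [cite: Zhang2022LandauSiegel, §2 Assumption (A)] -/
structure ZeroWorld where
  /-- multiplicity of `ρ` as a (nontrivial) zero of the slot `(q, ψ)`; `0` = not a zero -/
  mult : (q : ℕ) → DirichletCharacter ℂ q → ℂ → ℕ
  /-- the value `|L(1, ψ)|` of the slot -/
  LOne : (q : ℕ) → DirichletCharacter ℂ q → ℝ
  /-- the values `|L(½ + it, ψ)|` of the slot -/
  Lhalf : (q : ℕ) → DirichletCharacter ℂ q → ℝ → ℝ
  /-- the prime-counting data `ψ(x; q, a)` (Chebyshev), residue `a : ℕ` -/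
  psi : ℕ → ℕ → ℝ → ℝ

namespace ZeroWorld

variable (w : ZeroWorld)

/-- "`L(ρ, χ) = 0`" over the world (the zero set `Z(χ)` as data). [cite: BennettMartinOBryantRechnitzer2021, (1.2)] -/
def IsZero (q : ℕ) (χ : DirichletCharacter ℂ q) (ρ : ℂ) : Prop := 0 < w.mult q χ ρ

/-- `N(T, χ)` over the world (= `lfunctionZeroCount χ T`: `0 < Re ρ < 1`, `|Im ρ| ≤ T`, with multiplicity).
[cite: BennettMartinOBryantRechnitzer2021, (1.1)–(1.2)] -/
def stripCount (q : ℕ) (χ : DirichletCharacter ℂ q) (T : ℝ) : ℕ :=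
  ∑ᶠ ρ ∈ {ρ : ℂ | w.IsZero q χ ρ ∧ 0 < ρ.re ∧ ρ.re < 1 ∧ |ρ.im| ≤ T}, w.mult q χ ρ

/-- `{ρ : zero, Re ρ > σ, |Im ρ| ≤ H}` over the world (= `BondarenkoHeap2026.zeroSetRe`). [cite: ThornerZaman2024LogFree, §1 (1.2)] -/
def zeroSetRe (q : ℕ) (χ : DirichletCharacter ℂ q) (σ H : ℝ) : Set ℂ := {ρ | w.IsZero q χ ρ ∧ σ < ρ.re ∧ |ρ.im| ≤ H}

/-- `#{ρ : zero, Re ρ > σ, |Im ρ| ≤ H}` with multiplicity (= `BondarenkoHeap2026.charZeroCountRe`). [cite: ThornerZaman2024LogFree, §1 (1.2)] -/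
def charZeroCountRe (q : ℕ) (χ : DirichletCharacter ℂ q) (σ H : ℝ) : ℕ := ∑ᶠ ρ ∈ w.zeroSetRe q χ σ H, w.mult q χ ρ

/-- Real zeros of `𝓛(s,Q) = ∏_{q ≤ Q} ∏_{χ primitive} L(s,χ)` over the world (= `ThornerZaman2024.realZeroSet`).
[cite: ThornerZaman2024LogFree, §1 (1.1)] -/
def realZeroSet (Q : ℝ) : Set ℝ :=
  {β | ∃ i : ℕ, i < ⌊Q⌋₊ ∧ ∃ χ : DirichletCharacter ℂ (i + 1), χ.IsPrimitive ∧ w.IsZero (i + 1) χ β}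

/-- `β₁(Q)` over the world (= `ThornerZaman2024.betaOne`; `sSup ∅ = 0`). [cite: ThornerZaman2024LogFree, §1 (1.1)] -/
def betaOne (Q : ℝ) : ℝ := sSup (w.realZeroSet Q)

/-- `N(σ,Q)` over the world (= `ThornerZaman2024.zeroCount`). [cite: ThornerZaman2024LogFree, §1 (1.2)] -/
def zeroCount (σ Q : ℝ) : ℕ :=
  ∑ i ∈ Finset.range ⌊Q⌋₊, ∑ χ : DirichletCharacter ℂ (i + 1), if χ.IsPrimitive then w.charZeroCountRe (i + 1) χ σ Q else 0

/-- `N*(σ,Q)` over the world (= `ThornerZaman2024.zeroCountExcl`). [cite: ThornerZaman2024LogFree, §1 (1.2)] -/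
def zeroCountExcl (σ Q : ℝ) : ℕ :=
  ∑ i ∈ Finset.range ⌊Q⌋₊, ∑ χ : DirichletCharacter ℂ (i + 1),
    if χ.IsPrimitive then ∑ᶠ ρ ∈ w.zeroSetRe (i + 1) χ σ Q \ {((w.betaOne Q : ℝ) : ℂ)}, w.mult (i + 1) χ ρ else 0

/-- `BGTZ2025.HypothesisA A θ` on the world's half-line values. [cite: BenliGoelTwissZaman2025, Hypothesis 2.1] -/
def hypothesisA (A θ : ℝ) : Prop :=
  ∀ (q : ℕ) [NeZero q] (ψ : DirichletCharacter ℂ q), ψ.IsPrimitive → ∀ t : ℝ, w.Lhalf q ψ t ≤ A * ((q : ℝ) * (1 + |t|)) ^ θ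

/-! ## 2. The menu: one field per typed input row, verbatim over the world -/

/-- **THE MENU at the exceptional datum `(D, χ)`** — one field per typed row (module docstring lists field ↔ tree decl);
SCOPE: menu = EDLIST rows as rendered; a new row, or one rendered more strongly, re-opens the certificate.
[cite: Zhang2022LandauSiegel, §2 Assumption (A)] -/
structure Menu (D : ℕ) (χ : DirichletCharacter ℂ D) : Prop where
  /-- (A) = `Zhang2022.Skeleton.AssumptionA D χ`: `‖L(1,χ)‖ < 1/(log D)^2022`. -/
  assumptionA : w.LOne D χ < 1 / Real.log D ^ 2022
  /-- dhE-01 = `BGTZ2025.corollary11` (`Repulsion 10 1 107 (1/16) q T`, `q > 4·10⁵`, `T ≥ 4`). -/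
  row01 : ∀ (q : ℕ) [NeZero q], 400000 < q → ∀ T : ℝ, 4 ≤ T →
    ∀ (χ₁ : DirichletCharacter ℂ q) (β₁ : ℝ), 1 - 1 / (10 * Real.log q) < β₁ → β₁ < 1 → w.IsZero q χ₁ β₁ →
      ∀ (ψ : DirichletCharacter ℂ q) (ρ : ℂ), ρ ≠ 1 → ρ ≠ (β₁ : ℂ) → w.IsZero q ψ ρ →
        1 / 2 < ρ.re → |ρ.im| ≤ T → ρ.re < BGTZ2025.repulsionBound 10 1 107 (1 / 16) q T β₁
  /-- dhE-02 = `BGTZ2025.theorem13`. -/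
  row02 : ∀ (q : ℕ) [NeZero q], 400000 < q → ∀ T : ℝ, 4 ≤ T →
    ∀ A B θ ε : ℝ, 1 ≤ A → 1 ≤ B → 0 < θ → θ ≤ 1 / 4 → 0 < ε → ε ≤ 1 / 2 → w.hypothesisA A θ →
      ∀ (χ₁ : DirichletCharacter ℂ q) (β₁ : ℝ), 1 - 1 / (10 * Real.log q) < β₁ →
        β₁ < 1 - B / ((q : ℝ) ^ ε * Real.log q ^ 2) → w.IsZero q χ₁ β₁ →
          ∀ (ψ : DirichletCharacter ℂ q) (ρ : ℂ), ρ ≠ 1 → ρ ≠ (β₁ : ℂ) → w.IsZero q ψ ρ → 1 / 2 < ρ.re → |ρ.im| ≤ T →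
            ρ.re < 1 - Real.log (θ / (4 * (1 - β₁) * Real.log (BGTZ2025.theorem13M A B θ ε q T))) /
              Real.log (BGTZ2025.theorem13M A B θ ε q T)
  /-- dhE-03 = `BGTZ2025.proposition24_thornerZaman` ∧ the half-line display of `francis2022_theorem13`. -/
  row03 : w.hypothesisA 2.97655 (1 / 4) ∧
    ∀ (q : ℕ) [NeZero q], q.Prime → 10 ^ 10 ≤ q → ∀ ψ : DirichletCharacter ℂ q, ψ ≠ 1 → ψ.IsPrimitive →
      ∀ t : ℝ, 1 ≤ |t| → w.Lhalf q ψ t ≤ Francis2022.boundHalf q t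
  /-- dhE-04 = `thornerZaman2024_theorem12` ∧ `thornerZaman2024_corollary61`. -/
  row04 : (∀ Q : ℝ, 3 ≤ Q → ∀ σ : ℝ, 39 / 40 ≤ σ →
      (w.zeroCount σ Q : ℝ) ≤ 10 ^ 88 * (10 ^ 421 * Q ^ 99) ^ (1 - σ) ∧
        (w.zeroCountExcl σ Q : ℝ) ≤ 10 ^ 93 * min 1 ((1 - w.betaOne Q) * Real.log Q) * (10 ^ 466 * Q ^ 170) ^ (1 - σ)) ∧
    (∀ Q : ℝ, 3 ≤ Q → ∀ σ : ℝ, 0 ≤ σ →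
      (w.zeroCount σ Q : ℝ) ≤ 10 ^ 88 * (10 ^ 421 * Q ^ 127) ^ (1 - σ) ∧
        (w.zeroCountExcl σ Q : ℝ) ≤ 10 ^ 93 * min 1 ((1 - w.betaOne Q) * Real.log Q) * (10 ^ 466 * Q ^ 198) ^ (1 - σ))
  /-- dhE-05 = `thornerZaman2024_lemma24` ∧ `_corollary25` ∧ `_theorem26a` ∧ `_theorem26b`. -/
  row05 : (∀ (q q' : ℕ) [NeZero q] [NeZero q'] (ψ : DirichletCharacter ℂ q) (ψ' : DirichletCharacter ℂ q'),
      400000 < q → 400000 < q' → ψ.IsPrimitive → ψ.IsQuadratic → ψ'.IsPrimitive → ψ'.IsQuadratic →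
        (q ≠ q' ∨ ∃ h : q = q', h ▸ ψ ≠ ψ') → ∀ β β' : ℝ, w.IsZero q ψ β → w.IsZero q' ψ' β' →
          min β β' < 1 - ThornerZaman2024.landauConst / Real.log ((q' : ℝ) * q / 17)) ∧
    (∀ Q : ℝ, 3 ≤ Q →
      (∀ (q q' : ℕ) [NeZero q] [NeZero q'] (ψ : DirichletCharacter ℂ q) (ψ' : DirichletCharacter ℂ q'),
        (q : ℝ) ≤ Q → (q' : ℝ) ≤ Q → ψ.IsPrimitive → ψ.IsQuadratic → ψ'.IsPrimitive → ψ'.IsQuadratic →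
          ∀ β β' : ℝ, w.IsZero q ψ β → w.IsZero q' ψ' β' →
            1 - ThornerZaman2024.pageConst / Real.log Q ≤ β → 1 - ThornerZaman2024.pageConst / Real.log Q ≤ β' →
              β = β' ∧ ∃ h : q = q', h ▸ ψ = ψ') ∧
      (∀ (q : ℕ) [NeZero q] (ψ : DirichletCharacter ℂ q), (q : ℝ) ≤ Q → ψ.IsPrimitive → ψ.IsQuadratic →
        ∀ β : ℝ, w.IsZero q ψ β → 1 - ThornerZaman2024.pageConst / Real.log Q ≤ β → 400000 < q)) ∧
    (∀ Q : ℝ, 3 ≤ Q → ∀ (q : ℕ) [NeZero q] (ψ : DirichletCharacter ℂ q), (q : ℝ) ≤ Q → ψ.IsPrimitive →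
      ∀ ρ : ℂ, ρ ≠ 1 → ρ ≠ ((w.betaOne Q : ℝ) : ℂ) → w.IsZero q ψ ρ →
        ρ.re < 1 - ThornerZaman2024.zfrConst / Real.log (max Q (Q * |ρ.im|))) ∧
    (∀ Q : ℝ, 3 ≤ Q → 1 - ThornerZaman2024.zfrConst / Real.log Q ≤ w.betaOne Q →
      400000 < Q ∧ ∃ (q₁ : ℕ) (_ : NeZero q₁) (χ₁ : DirichletCharacter ℂ q₁),
        400000 < q₁ ∧ (q₁ : ℝ) ≤ Q ∧ χ₁.IsPrimitive ∧ w.IsZero q₁ χ₁ (w.betaOne Q) ∧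
          w.betaOne Q ≤ 1 - 100 / (Real.sqrt q₁ * Real.log q₁ ^ 2))
  /-- dhE-06 = `thornerZaman2024_theorem215` (`ThornerZaman2024.dhBound`). -/
  row06 : ∀ Q T : ℝ, 400000 < Q → 1 ≤ T → 1 - ThornerZaman2024.zfrConst / Real.log Q ≤ w.betaOne Q →
    ∀ (q : ℕ) [NeZero q] (ψ : DirichletCharacter ℂ q), (q : ℝ) ≤ Q → ψ.IsPrimitive →
      ∀ ρ : ℂ, ρ ≠ 1 → ρ ≠ ((w.betaOne Q : ℝ) : ℂ) → w.IsZero q ψ ρ →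
        1 / 2 < ρ.re → |ρ.im| ≤ T → ρ.re ≤ ThornerZaman2024.dhBound Q T (w.betaOne Q)
  /-- dhE-08 = `McCurley1984_theorem1` (`AtMostOneZeroInRegion 9.645908801 10`) ∧ `luZamanZhao2026_theorem11`. -/
  row08 : (∀ (q : ℕ) [NeZero q], 3 ≤ q → ∀ (χ₁ χ₂ : DirichletCharacter ℂ q) (s₁ s₂ : ℂ), s₁ ≠ 1 → s₂ ≠ 1 →
      1 - 1 / (9.645908801 * Real.log (max (max (q : ℝ) ((q : ℝ) * |s₁.im|)) 10)) < s₁.re →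
      1 - 1 / (9.645908801 * Real.log (max (max (q : ℝ) ((q : ℝ) * |s₂.im|)) 10)) < s₂.re →
        w.IsZero q χ₁ s₁ → w.IsZero q χ₂ s₂ → (χ₁ = χ₂ ∧ s₁ = s₂) ∧ s₁.im = 0 ∧ χ₁ ≠ 1 ∧ χ₁ ^ 2 = 1) ∧
    (∀ (q : ℕ) [NeZero q], q ≤ 10 ^ 10 → ∀ ψ : DirichletCharacter ℂ q, ψ.IsQuadratic → ψ ≠ 1 →
      ∀ σ : ℝ, 1 - 1 / (5 * Real.log q) ≤ σ → ¬ w.IsZero q ψ σ)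
  /-- dhE-09 = `BGTZ2025.lemma29` (`LOne` = the real number `L(1,χ₁)` of a quadratic `χ₁`). -/
  row09 : ∀ (q : ℕ) [NeZero q], 400000 < q → ∀ χ₁ : DirichletCharacter ℂ q, χ₁.IsQuadratic → χ₁ ≠ 1 →
    ∀ β₁ : ℝ, 1 - 1 / (10 * Real.log q) < β₁ → β₁ < 1 → w.IsZero q χ₁ β₁ →
      0.72 * (1 - β₁) ≤ w.LOne q χ₁ ∧ w.LOne q χ₁ ≤ 0.18 * Real.log q ^ 2 * (1 - β₁)
  /-- dhE-10 = `BGTZ2025.theorem28_bordignon` (`HypothesisB 100 (1/2)`) ∧ `one_sub_realZero_ge_explicit_of_eight_le`. -/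
  row10 : (∀ (q : ℕ) [NeZero q], 3 ≤ q → ∀ (ψ : DirichletCharacter ℂ q) (β₁ : ℝ),
      1 - 1 / (10 * Real.log q) < β₁ → β₁ < 1 → w.IsZero q ψ β₁ → β₁ < 1 - 100 / ((q : ℝ) ^ (1 / 2 : ℝ) * Real.log q ^ 2)) ∧
    (∀ (q : ℕ) [NeZero q], 8 ≤ q → ∀ ψ : DirichletCharacter ℂ q, ψ.IsPrimitive → ψ.IsQuadratic →
      ∀ β : ℝ, w.IsZero q ψ β → 1 / (80 * Real.sqrt q * Real.log q ^ 2) ≤ 1 - β)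
  /-- dhE-11 = `DirichletLOneLogBound.norm_LFunction_one_le_log`: `‖L(1,χ)‖ ≤ log q`, `χ ≠ χ₀`. -/
  row11 : ∀ (q : ℕ) [NeZero q] (ψ : DirichletCharacter ℂ q), ψ ≠ 1 → w.LOne q ψ ≤ Real.log q
  /-- dhE-12 = the conclusion shape of the tree theorem `Zhang2022.DH.exceptionalZero_of_assumptionA` (ls-Bdh-typer-1,
  `DHChainInputs.lean`) at the datum `(D, χ)`, `D > 4·10⁵`: (A) ⇒ a SIMPLE real zero `β₁ ∈ (1 − 1/(10 log D), 1)` of slot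
  `(D, χ)`, `χ² = χ₀`, the only real zero of ANY slot `(D, ψ)` in that window, `0.72 (1 − β₁) ≤ ‖L(1,χ)‖`, and
  `1 − β₁ < (25/18)(log D)⁻²⁰²²`. -/
  row12 : w.LOne D χ < 1 / Real.log D ^ 2022 → 400000 < D →
    ∃ β₁ : ℝ, 1 - 1 / (10 * Real.log D) < β₁ ∧ β₁ < 1 ∧ w.mult D χ β₁ = 1 ∧ χ ^ 2 = 1 ∧
      (∀ (ψ : DirichletCharacter ℂ D) (β : ℝ), 1 - 1 / (10 * Real.log D) < β → β < 1 → w.IsZero D ψ β →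
          ψ = χ ∧ β = β₁) ∧
      0.72 * (1 - β₁) ≤ w.LOne D χ ∧ 1 - β₁ < 25 / 18 / Real.log D ^ 2022
  /-- dhE-13 = `bmor2021_theorem11` on `stripCount` (`bmorEll`, `charParity` of the tree). The binders `1 < q` and `ψ.IsPrimitive`
  are verbatim AND load-bearing for the world: clause (a) (`N_W(T) = 0` when `ℓ ≤ 1.567`) needs `F_q(T) < 1` on
  `{T ≥ 5/7, q(T+2) ≤ 2πe^{1.567}}`, which holds for `3 ≤ q ≤ 11` (sup `F₃ = 0.8820` at `T = 8.0368`, margin `0.118`; `≤ −0.54` for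
  `4 ≤ q ≤ 11`; the region is empty for `q ≥ 12`) but would FAIL at `q = 1, 2` — excluded exactly by `1 < q` and by "no primitive
  character mod 2"; clause (b): `|N_W − F| ≤ 1 ⇒ 5/4 ≤ band(ℓ) − 0.4918` for `ℓ ≥ 1.567` (ls-Bdh-num-1 kit j258910, certified). -/
  row13 : ∀ (q : ℕ) [NeZero q], 1 < q → ∀ ψ : DirichletCharacter ℂ q, ψ.IsPrimitive → ∀ T : ℝ, 5 / 7 ≤ T →
    (bmorEll q T ≤ 1.567 → w.stripCount q ψ T = 0) ∧
    (1.567 < bmorEll q T →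
      |(w.stripCount q ψ T : ℝ) - (T / Real.pi * Real.log (q * T / (2 * Real.pi * Real.exp 1)) - (-1) ^ charParity ψ / 4)| ≤
        0.22737 * bmorEll q T + 2 * Real.log (1 + bmorEll q T) - 0.5)
  /-- dhE-15 = `RealZeroRepulsion.norm_LFunction_one_ge`: `0.69/√q ≤ ‖L(1,χ)‖`, real primitive `χ` mod `q ≥ 3`. -/
  row15 : ∀ (q : ℕ) [NeZero q], 3 ≤ q → ∀ ψ : DirichletCharacter ℂ q, ψ.IsPrimitive → ψ.IsQuadratic →
    (69 / 100) / Real.sqrt q ≤ w.LOne q ψ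
  /-- dhE-19 = `lamzouriLiSoundararajan2015_theorem15`; its hypothesis is the tree's GLOBAL `GeneralizedRiemannHypothesis`
  (every zero of every Dirichlet `L`-function on `Re s = ½`), rendered verbatim as a global hypothesis on the world (REF-B3 V2
  checked: the decl is global, not per-character). -/
  row19 : (∀ (q : ℕ) (ψ : DirichletCharacter ℂ q) (ρ : ℂ), w.IsZero q ψ ρ → ρ.re = 1 / 2) →
    ∀ (q : ℕ) [NeZero q] (ψ : DirichletCharacter ℂ q), ψ.IsPrimitive → (10 : ℝ) ^ 10 ≤ (q : ℝ) →
      w.LOne q ψ ≤ 2 * Real.exp Real.eulerMascheroniConstant * LamzouriLiSoundararajan2015.upperBracket q ∧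
        1 / w.LOne q ψ ≤ 12 * Real.exp Real.eulerMascheroniConstant / Real.pi ^ 2 * LamzouriLiSoundararajan2015.lowerBracket q
  /-- S1 (A4): the zero data of `ψ̄ = ψ⁻¹` are the conjugates of those of `ψ`, and each slot is closed under `ρ ↦ 1 − ρ̄`. -/
  rowS1 : ∀ (q : ℕ) (ψ : DirichletCharacter ℂ q) (ρ : ℂ),
    w.mult q ψ⁻¹ (starRingEnd ℂ ρ) = w.mult q ψ ρ ∧ w.mult q ψ (1 - starRingEnd ℂ ρ) = w.mult q ψ ρ
  /-- S2 (A4): the counts are monotone (`N(T)` in `T`; the box count in `H` and anti-monotone in `σ`). -/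
  rowS2 : ∀ (q : ℕ) (ψ : DirichletCharacter ℂ q) (σ σ' T T' : ℝ), σ' ≤ σ → T ≤ T' →
    w.stripCount q ψ T ≤ w.stripCount q ψ T' ∧ w.charZeroCountRe q ψ σ T ≤ w.charZeroCountRe q ψ σ' T'
  /-- S3 (A4): `|L(1,ψ)| > 0` for `ψ ≠ χ₀` (Dirichlet), `|L(1,ψ̄)| = |L(1,ψ)|`, `|L(½+it,ψ)| ≥ 0`. -/
  rowS3 : ∀ (q : ℕ) [NeZero q] (ψ : DirichletCharacter ℂ q),
    (ψ ≠ 1 → 0 < w.LOne q ψ) ∧ w.LOne q ψ⁻¹ = w.LOne q ψ ∧ ∀ t : ℝ, 0 ≤ w.Lhalf q ψ t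
  /-- S4 (A4): an imprimitive `ψ` carries every zero of its primitive inducer, and no other zero off `Re s = 0`. -/
  rowS4 : ∀ (q : ℕ) [NeZero q] (ψ : DirichletCharacter ℂ q) (ρ : ℂ),
    (w.IsZero ψ.conductor ψ.primitiveCharacter ρ → w.IsZero q ψ ρ) ∧
      (w.IsZero q ψ ρ → w.IsZero ψ.conductor ψ.primitiveCharacter ρ ∨ ρ.re = 0)

end ZeroWorld

/-! ## 3. The (A)-world `W(D, χ)` -/

/-- `λ(D) := 1/(2 (log D)^2022)`, half the (A)-cap (R3). [cite: Zhang2022LandauSiegel, §2 Assumption (A)] -/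
def lam (D : ℕ) : ℝ := 1 / (2 * Real.log D ^ 2022)

/-- `β₁(D) := 1 − λ(D)/0.75` (slack `0.72 < 0.75` for Lemma 2.9, R3). [cite: BenliGoelTwissZaman2025, Lemma 2.9] -/
def betaExc (D : ℕ) : ℝ := 1 - lam D / 0.75

/-- The Riemann–von Mangoldt main term `F_f(T) = (T/π) log(fT/(2πe))` at conductor `f`. [cite: BennettMartinOBryantRechnitzer2021, Theorem 1.1] -/
def rvmMain (f : ℕ) (T : ℝ) : ℝ := T / Real.pi * Real.log (f * T / (2 * Real.pi * Real.exp 1))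

/-- The `n`-th fence ordinate at conductor `f`: `γ_n(f) := inf{T ≥ 0 : 2n − 1 ≤ F_f(T)}`, so that the symmetric fence
`{½ ± iγ_n : n ≥ 1}` has `N(T) = 2⌊(F_f(T)+1)/2⌋₊`. [cite: BennettMartinOBryantRechnitzer2021, Theorem 1.1] -/
def fenceOrdinate (f n : ℕ) : ℝ := sInf {T : ℝ | 0 ≤ T ∧ (2 * (n : ℝ) - 1) ≤ rvmMain f T}

/-- The symmetric picket fence at conductor `f`: `½ ± iγ_n(f)`, `n ≥ 1`. [folklore] -/
def fence (f : ℕ) : Set ℂ :=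
  Set.range (fun n : ℕ => (1 / 2 : ℂ) + ((fenceOrdinate f (n + 1) : ℝ) : ℂ) * I) ∪
    Set.range (fun n : ℕ => (1 / 2 : ℂ) - ((fenceOrdinate f (n + 1) : ℝ) : ℂ) * I)

/-- Induced slots: `D ∣ q` and `ψ` is `χ` raised to level `q`. [cite: MontgomeryVaughan2007, §9.1] -/
def IsExcSlot (D : ℕ) (χ : DirichletCharacter ℂ D) (q : ℕ) (ψ : DirichletCharacter ℂ q) : Prop :=
  ∃ h : D ∣ q, ψ = DirichletCharacter.changeLevel h χ

/-- The exceptional pair `{β₁, 1 − β₁}`. [folklore] -/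
def excPair (D : ℕ) : Set ℂ := {((betaExc D : ℝ) : ℂ), ((1 - betaExc D : ℝ) : ℂ)}

/-- **The (A)-world `W(D, χ)`** (KILL-draft §3 / ref-3 D2): conductor fences, the exceptional pair and `LOne = λ` on the
induced slots, `LOne = 1` elsewhere, `Lhalf ≡ 1`, Siegel main terms for `ψ(x;q,a)`. [cite: Zhang2022LandauSiegel, §2 Assumption (A)] -/
def world (D : ℕ) (χ : DirichletCharacter ℂ D) : ZeroWorld where
  mult q ψ ρ := (if ρ ∈ fence ψ.conductor then 1 else 0) + (if IsExcSlot D χ q ψ ∧ ρ ∈ excPair D then 1 else 0)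
  LOne q ψ := if IsExcSlot D χ q ψ then lam D else 1
  Lhalf _ _ _ := 1
  psi q a x :=
    if Nat.Coprime a q then
      (x - (if D ∣ q then (χ (a : ZMod D)).re * x ^ betaExc D / betaExc D else 0)) / Nat.totient q
    else 0

/-! ## 4. The certificate statement (B-DH-W) -/

/-- **B-DH-W = `MenuConsistent` (dhE-24; KILL-certificate TARGET, proof → §E).** For every modulus `D` with `log D ≥ 43 250`
and every primitive quadratic `χ ≠ χ₀` mod `D`, the (A)-world satisfies the whole rendered menu: `Menu (world D χ) D χ`.
SCOPE (ls-ref-1 (b) / A7): menu = the EDLIST rows rendered as fields of `ZeroWorld.Menu`; any further row re-opens the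
certificate. A bare `Prop`, asserted by no one. [cite: Zhang2022LandauSiegel, §2 Assumption (A)] -/
def MenuConsistent : Prop :=
  ∀ (D : ℕ) [NeZero D] (χ : DirichletCharacter ℂ D), χ.IsPrimitive → χ.IsQuadratic → χ ≠ 1 →
    (43250 : ℝ) ≤ Real.log D → (world D χ).Menu D χ

/-! ## 5. Proved bookkeeping on the world's constants -/

/-- `λ(D) < 1/(log D)^2022` for `log D > 0`. [cite: Zhang2022LandauSiegel, §2 Assumption (A)] -/
theorem lam_lt_cap {D : ℕ} (hD : 0 < Real.log D) : lam D < 1 / Real.log D ^ 2022 := by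
  unfold lam
  have h : 0 < Real.log D ^ 2022 := pow_pos hD _
  rw [div_lt_div_iff₀ (by positivity) h]
  nlinarith

/-- (A) holds in `W(D, χ)` at the slot `(D, χ)` (`log D > 0`) — the field `Menu.assumptionA` of the target.
[cite: Zhang2022LandauSiegel, §2 Assumption (A)] -/
theorem world_assumptionA {D : ℕ} (hD : 0 < Real.log D) (χ : DirichletCharacter ℂ D) :
    (world D χ).LOne D χ < 1 / Real.log D ^ 2022 := by
  have hslot : IsExcSlot D χ D χ := ⟨dvd_rfl, (DirichletCharacter.changeLevel_self χ).symm⟩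
  show (if IsExcSlot D χ D χ then lam D else 1) < 1 / Real.log D ^ 2022
  rw [if_pos hslot]
  exact lam_lt_cap hD

/-- Lemma 2.9's two sides at the world's datum: `0.72 (1 − β₁) = 0.96 λ ≤ λ`, and `λ ≤ 0.18 L² (1 − β₁)` once `0.24 L² ≥ 1`.
[cite: BenliGoelTwissZaman2025, Lemma 2.9] -/
theorem lemma29_sides_at_world {D : ℕ} (hD : 0 < Real.log D) {L : ℝ} (hL : 1 ≤ 0.24 * L ^ 2) :
    0.72 * (1 - betaExc D) ≤ lam D ∧ lam D ≤ 0.18 * L ^ 2 * (1 - betaExc D) := by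
  have hlam : 0 < lam D := by unfold lam; positivity
  have h1 : 1 - betaExc D = lam D / 0.75 := by unfold betaExc; ring
  rw [h1]
  constructor
  · have : 0.72 * (lam D / 0.75) = 0.96 * lam D := by ring
    rw [this]; nlinarith
  · have : 0.18 * L ^ 2 * (lam D / 0.75) = 0.24 * L ^ 2 * lam D := by ring
    rw [this]; nlinarith [mul_le_mul_of_nonneg_right hL hlam.le]

end Literature.NumberTheory.LFunctions.Zhang2022.DH

end
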